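/-
Copyright (c) 2026 the pub-hodgecm-mathlib formalisation cell (harness21).  Prover seat hodgecm-mathlib-F0P3a-p03 (g21), 2026-09-02 (LH7 leaf ED. 3 road, letter O8a, step (4) = (M1)
of `F0/P3a/F0P3a-p03/g21/CENSUS-O8a-PKsaU2.F0P3ap03g21.md`: strong approximation for `SU(antidiag(1,1))` — part B, «every unitary adelic transvection is a limit of
rational · `v₁`-local ones»).
-/
import Literature.NumberTheory.Automorphic.UnitaryGroupAdelicTransvections            -- ★ p850635 (this seat): part A
import Literature.NumberTheory.Automorphic.AdeleRingStrongApproximationFinitePlace     -- ★ `AdeleRing.exists_sub_algebraMap_sub_adeleSingleHom_mem` (`K + K_{v₀}` dense in `𝔸_K`)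
import HarnessLib

/-!
# Every unitary adelic transvection of `U(antidiag(1,1))(𝔸_F)` lies in the closure of the subgroup generated by `SU(J)(F)` and `ι_{v₁} SU(J)(F_{v₁})`

Registry: pub-hodgecm MODEL-CONSTRUCTION sub-cell; second of the files proving STRONG APPROXIMATION for `SU(antidiag(1,1)) ≅ SL₂` with one FINITE place `v₁` free (the
number-theoretic input of the LH7 letter O8a `PKsaU2Shape`; [PlatonovRapinchuk1994] §7.4 Thm. 7.12, [Kneser1966]).  THEOREMS ONLY: no definition, no named fact, no instance, no notation,
no `sorry`.

THE MATHEMATICS.  `E ∕ F` number fields with an involution `c ∈ Aut(E ∕ F)` (`c · c = 1`), `J = antidiag(1,1)`, `v₁` a finite place of `F`, `w₁ ∣ v₁` a place of `E`.  Let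
`H := ⟨ SU(J)(F) ∪ ι_{v₁}(SU(J)(F_{v₁})) ⟩ ≤ U(J)(𝔸_F)` (subgroup closure of the images of the determinant-one rational points under ★ `toAdelic` and of the determinant-one elements of
`U(J)(F_{v₁})` under ★ `inclPlaceAdelic v₁`) and `C := H̄` its topological closure.  CLAIM (`units_transvection_mem_topologicalClosure`): every unitary adelic transvection `T_{ij}(y)`,
`y ∈ 𝔸_E`, `(c ⊗ 1) y = −y`, lies in `C`.  PROOF: by STRONG APPROXIMATION for the additive group of `E` with the place `w₁` free (★ `AdeleRing.exists_sub_algebraMap_sub_adeleSingleHom_mem`: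
`E + E_{w₁}` is dense in `𝔸_E`), for every neighbourhood `W` of `0` there are `k ∈ E` and `z ∈ E_{w₁}` with `y − k ⊗ 1 − (z at w₁) ∈ W`; apply the anti-symmetrisation
`ψ(e) = ½ (e − (c ⊗ 1) e)` (continuous, additive, `ψ(y) = y`): `y = ψ(k ⊗ 1) + ψ(z at w₁) + ψ(small)` with `ψ(k ⊗ 1) = ((k − ck)∕2) ⊗ 1` RATIONAL anti-fixed and `ψ(z at w₁)` anti-fixed,
without archimedean component and supported at `{w₁, c w₁}` — places over `v₁`; so `T(y)` is approximated by `T(ψ(k ⊗ 1)) · T(ψ(z at w₁)) ∈ SU(J)(F) · ι_{v₁}(SU(J)(F_{v₁})) ⊆ H`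
(part A ★ p850635: `units_transvection_algebraMap_mem_image_toAdelic`, `exists_inclPlaceAdelic_eq_units_transvection`; continuity of `x ↦ T(x)`, `continuous_units_transvection`).
CONSUMER: part C (`UnitaryGroupRankTwoStrongApproximation`: the unit-pivot word puts every determinant-one element of `U(J)(𝔸_F)` in `C`).  HONEST LABEL: model plumbing over ★ additive strong
approximation ([CasselsFrohlichANT1967] II §15); HC_CM is proved only modulo the printed citations of that programme until its rung 0 closes; this file proves no printed citation of it.

## References
* [PlatonovRapinchuk1994] V. Platonov, A. Rapinchuk, *Algebraic Groups and Number Theory* (1994), §7.4 Thm. 7.12 (strong approximation), §5.1.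
* [Kneser1966] M. Kneser, *Strong approximation*, Proc. Sympos. Pure Math. IX (1966) 187–196.
* [CasselsFrohlichANT1967] J. W. S. Cassels, A. Fröhlich (eds.), *Algebraic Number Theory* (1967), Ch. II §15 (strong approximation theorem), Ch. VII §1.1.
-/

set_option autoImplicit false

noncomputable section

open Matrix NumberField IsDedekindDomain Topology

namespace Literature.NumberTheory.Automorphic

namespace UnitaryGroup

variable (F E : Type) [Field F] [NumberField F] [Field E] [NumberField E] [Algebra F E]
variable (c : E ≃ₐ[F] E)

/-! ## §1 The anti-symmetrisation `ψ(e) = ½ (e − (c ⊗ 1) e)` -/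

omit [NumberField F] in
/-- `c ⊗ 1` is an involution of `𝔸_E` when `c · c = 1` (private copy of ★ `UnitaryGroupGlobalGenericity.conjAdele_conjAdele`, to keep the import light). [folklore] -/
private theorem conjAdele_conjAdele' (hcc : c * c = 1) (x : AdeleRing (𝓞 E) E) : conjAdele F E c (conjAdele F E c x) = x := by
  rw [conjAdele_apply, conjAdele_apply, ← mul_smul, hcc, one_smul]

omit [NumberField F] in
/-- the anti-symmetrisation `ψ(e) = ½ (e − (c ⊗ 1) e)` is `(c ⊗ 1)`-anti-fixed. [cite: CasselsFrohlichANT1967, Ch. VII §1.1] -/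
theorem conjAdele_antisym (hcc : c * c = 1) (e : AdeleRing (𝓞 E) E) :
    conjAdele F E c (algebraMap E (AdeleRing (𝓞 E) E) 2⁻¹ * (e - conjAdele F E c e)) = -(algebraMap E (AdeleRing (𝓞 E) E) 2⁻¹ * (e - conjAdele F E c e)) := by
  have h2 : conjAdele F E c (algebraMap E (AdeleRing (𝓞 E) E) 2⁻¹) = algebraMap E (AdeleRing (𝓞 E) E) 2⁻¹ := by
    rw [← algebraMap_conj]
    change algebraMap E (AdeleRing (𝓞 E) E) (c 2⁻¹) = _
    rw [map_inv₀, map_ofNat]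
  rw [map_mul, h2, map_sub, conjAdele_conjAdele' F E c hcc, ← mul_neg, neg_sub]

omit [NumberField F] in
/-- `ψ(y) = y` for an anti-fixed `y`. [cite: CasselsFrohlichANT1967, Ch. VII §1.1] -/
theorem antisym_eq_self_of_conjAdele_eq_neg {y : AdeleRing (𝓞 E) E} (hy : conjAdele F E c y = -y) :
    algebraMap E (AdeleRing (𝓞 E) E) 2⁻¹ * (y - conjAdele F E c y) = y := by
  rw [hy, sub_neg_eq_add, ← two_mul, ← mul_assoc, ← map_ofNat (algebraMap E (AdeleRing (𝓞 E) E)) 2, ← map_mul, inv_mul_cancel₀ (two_ne_zero' E), map_one, one_mul]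

omit [NumberField F] in
/-- `ψ(k ⊗ 1) = ((k − c k)∕2) ⊗ 1`. [cite: CasselsFrohlichANT1967, Ch. VII §1.1] -/
theorem antisym_algebraMap (k : E) :
    algebraMap E (AdeleRing (𝓞 E) E) 2⁻¹ * (algebraMap E (AdeleRing (𝓞 E) E) k - conjAdele F E c (algebraMap E (AdeleRing (𝓞 E) E) k)) =
      algebraMap E (AdeleRing (𝓞 E) E) (2⁻¹ * (k - c k)) := by
  rw [← algebraMap_conj]
  change _ * (_ - algebraMap E (AdeleRing (𝓞 E) E) (c k)) = _
  rw [← map_sub, ← map_mul]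

omit [NumberField F] [NumberField E] in
/-- `c ((k − c k)∕2) = −((k − c k)∕2)` when `c · c = 1`. [cite: CasselsFrohlichANT1967, Ch. VII §1.1] -/
theorem map_antisym_rat (hcc : c * c = 1) (k : E) : c (2⁻¹ * (k - c k)) = -(2⁻¹ * (k - c k)) := by
  have hck : c (c k) = k := by rw [← AlgEquiv.mul_apply, hcc, AlgEquiv.one_apply]
  rw [map_mul, map_inv₀, map_ofNat, map_sub, hck, ← mul_neg, neg_sub]

/-! ## §2 Every unitary adelic transvection lies in the closure of `⟨SU(J)(F) ∪ ι_{v₁} SU(J)(F_{v₁})⟩` -/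

/-- **THE TRANSVECTION STEP OF STRONG APPROXIMATION FOR `SU(antidiag(1,1))`.**  `c · c = 1`, `J = antidiag(1,1)`, `v₁` a finite place of `F` with a place `w₁` of `E` above it.  For every
`y ∈ 𝔸_E` with `(c ⊗ 1) y = −y` and `{i, j} = {0, 1}`, the unitary adelic transvection `T_{ij}(y) ∈ U(J)(𝔸_F)` (★ `units_transvection_mem_adelic`) lies in the topological closure of the
subgroup generated by `toAdelic '' {γ ∈ U(J)(F) | det γ = 1}` and `inclPlaceAdelic v₁ '' {u ∈ U(J)(F_{v₁}) | ∀ w ∣ v₁, det u_w = 1}`.  (Additive strong approximation with `w₁` free, ★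
`AdeleRing.exists_sub_algebraMap_sub_adeleSingleHom_mem`, anti-symmetrised by `ψ(e) = ½(e − (c ⊗ 1) e)`; see the module docstring.)
[cite: CasselsFrohlichANT1967, Ch. II §15 Theorem] [cite: PlatonovRapinchuk1994, §7.4 Thm. 7.12 (proof, unipotent step)] -/
theorem units_transvection_mem_topologicalClosure (hcc : c * c = 1) {J : Matrix (Fin 2) (Fin 2) E} (hJ2 : J = !![0, 1; 1, 0])
    {v₁ : HeightOneSpectrum (𝓞 F)} (w₁ : PlacesOver E v₁) (i j : Fin 2) (hij : i ≠ j) (y : AdeleRing (𝓞 E) E) (hy : conjAdele F E c y = -y) :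
    (⟨⟨(⟨i, j, hij, y⟩ : TransvectionStruct (Fin 2) (AdeleRing (𝓞 E) E)).toMatrix, (⟨i, j, hij, y⟩ : TransvectionStruct (Fin 2) (AdeleRing (𝓞 E) E)).inv.toMatrix,
        TransvectionStruct.mul_inv _, TransvectionStruct.inv_mul _⟩, units_transvection_mem_adelic F E c hJ2 ⟨i, j, hij, y⟩ hy⟩ : (adelicGroupData F E c 2 J).Adelic) ∈
      (Subgroup.closure (toAdelic F E c 2 J '' {γ : rational F E c 2 J | ((γ : GL (Fin 2) E) : Matrix (Fin 2) (Fin 2) E).det = 1} ∪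
        inclPlaceAdelic F E c 2 J v₁ '' {u : ↥(localPi E c 2 J v₁) |
          ∀ w : PlacesOver E v₁, (((u : LocalGLPi E 2 v₁) w : GL (Fin 2) (w.1.adicCompletion E)) : Matrix (Fin 2) (Fin 2) (w.1.adicCompletion E)).det = 1})).topologicalClosure := by
  -- notation-free abbreviations
  set H := Subgroup.closure (toAdelic F E c 2 J '' {γ : rational F E c 2 J | ((γ : GL (Fin 2) E) : Matrix (Fin 2) (Fin 2) E).det = 1} ∪
        inclPlaceAdelic F E c 2 J v₁ '' {u : ↥(localPi E c 2 J v₁) |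
          ∀ w : PlacesOver E v₁, (((u : LocalGLPi E 2 v₁) w : GL (Fin 2) (w.1.adicCompletion E)) : Matrix (Fin 2) (Fin 2) (w.1.adicCompletion E)).det = 1}) with hH
  -- the transvection map `Φ : 𝔸_E → GL₂(𝔸_E)` and the anti-symmetrisation `ψ`
  let Φ : AdeleRing (𝓞 E) E → GL (Fin 2) (AdeleRing (𝓞 E) E) := fun x =>
    ⟨(⟨i, j, hij, x⟩ : TransvectionStruct (Fin 2) (AdeleRing (𝓞 E) E)).toMatrix, (⟨i, j, hij, x⟩ : TransvectionStruct (Fin 2) (AdeleRing (𝓞 E) E)).inv.toMatrix,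
      TransvectionStruct.mul_inv _, TransvectionStruct.inv_mul _⟩
  have hΦc : Continuous Φ := UnitaryOneOne.continuous_units_transvection i j hij
  have hΦmul : ∀ a b : AdeleRing (𝓞 E) E, Φ a * Φ b = Φ (a + b) := fun a b =>
    Units.ext (by change transvection i j a * transvection i j b = transvection i j (a + b); exact transvection_mul_transvection_same i j hij a b)
  let ψ : AdeleRing (𝓞 E) E → AdeleRing (𝓞 E) E := fun e => algebraMap E (AdeleRing (𝓞 E) E) 2⁻¹ * (e - conjAdele F E c e)
  have hψc : Continuous ψ := continuous_const.mul (continuous_id.sub (AdeleRing.continuous_smul F c))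
  have hψadd : ∀ a b : AdeleRing (𝓞 E) E, ψ (a - b) = ψ a - ψ b := fun a b => by
    change _ * (_ - conjAdele F E c _) = _ * (_ - conjAdele F E c _) - _ * (_ - conjAdele F E c _)
    rw [map_sub]; ring
  have hψy : ψ y = y := antisym_eq_self_of_conjAdele_eq_neg F E c hy
  -- closure criterion in the subtype `U(J)(𝔸_F)`
  rw [← SetLike.mem_coe, Subgroup.topologicalClosure_coe, mem_closure_iff_nhds]
  intro N hN
  obtain ⟨O, hO, hON⟩ := (mem_nhds_subtype _ _ _).1 hN
  -- pull `O` back to a neighbourhood of `y` in `𝔸_E`, then through `e ↦ y − ψ e` to a neighbourhood `W` of `0`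
  have hOy : Φ ⁻¹' O ∈ 𝓝 y := hΦc.continuousAt.preimage_mem_nhds hO
  have hW : (fun e => y - ψ e) ⁻¹' (Φ ⁻¹' O) ∈ 𝓝 (0 : AdeleRing (𝓞 E) E) := by
    have hcont : Continuous fun e : AdeleRing (𝓞 E) E => y - ψ e := Continuous.sub continuous_const hψc
    refine hcont.continuousAt.preimage_mem_nhds ?_
    have h0 : y - ψ 0 = y := by
      change y - _ * (0 - conjAdele F E c 0) = y
      rw [map_zero, sub_zero, mul_zero, sub_zero]
    convert hOy using 2
  -- strong approximation with `w₁` free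
  obtain ⟨k, z, hkz⟩ := AdeleRing.exists_sub_algebraMap_sub_adeleSingleHom_mem E w₁.1 y hW
  -- the two letters: rational `q := ψ(k ⊗ 1)` and `v₁`-local `r := ψ(z at w₁)`
  set q : E := 2⁻¹ * (k - c k) with hq
  have hqc : c q = -q := map_antisym_rat F E c hcc k
  set r : AdeleRing (𝓞 E) E := ψ (adeleSingleHom E w₁.1 z) with hr
  have hrc : conjAdele F E c r = -r := conjAdele_antisym F E c hcc _
  have hsum : algebraMap E (AdeleRing (𝓞 E) E) q + r ∈ Φ ⁻¹' O := by
    have h := hkz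
    change y - ψ (y - algebraMap E (AdeleRing (𝓞 E) E) k - adeleSingleHom E w₁.1 z) ∈ Φ ⁻¹' O at h
    have hψk : ψ (algebraMap E (AdeleRing (𝓞 E) E) k) = algebraMap E (AdeleRing (𝓞 E) E) q := antisym_algebraMap F E c k
    rwa [hψadd, hψadd, hψy, hψk, sub_sub, sub_sub_cancel] at h
  -- `r` has no archimedean component and is supported over `v₁`
  have hr1 : r.1 = 0 := by
    change (algebraMap E (AdeleRing (𝓞 E) E) 2⁻¹).1 * ((adeleSingleHom E w₁.1 z).1 - (conjAdele F E c (adeleSingleHom E w₁.1 z)).1) = 0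
    rw [conjAdele_apply, AdeleRing.smul_fst, adeleSingleHom_apply_fst, smul_zero, sub_zero, mul_zero]
  have hr2 : ∀ w : HeightOneSpectrum (𝓞 E), w.under (𝓞 F) ≠ v₁ → r.2 w = 0 := by
    intro w hw
    have hw₁ : w ≠ w₁.1 := fun h => hw (by rw [h, w₁.2])
    have hw₁' : c⁻¹ • w ≠ w₁.1 := fun h => hw (by rw [← w₁.2, ← h, HeightOneSpectrum.under_algEquiv_smul])
    change (algebraMap E (AdeleRing (𝓞 E) E) 2⁻¹).2 w * ((adeleSingleHom E w₁.1 z).2 w - (conjAdele F E c (adeleSingleHom E w₁.1 z)).2 w) = 0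
    rw [conjAdele_snd, conjFiniteAdele_apply_apply, adeleSingleHom_apply_snd, finiteAdeleSingleHom_apply_of_ne E _ _ hw₁, finiteAdeleSingleHom_apply_of_ne E _ _ hw₁',
      map_zero, sub_zero, mul_zero]
  -- the `v₁`-local letter is `ι_{v₁}` of a determinant-one element
  obtain ⟨u, hu, hιu⟩ := exists_inclPlaceAdelic_eq_units_transvection F E c hJ2 v₁ i j hij r hrc hr1 hr2
  -- assemble the approximant `h = toAdelic(T(q)) · ι_{v₁}(T(r)) ∈ H ∩ N`
  refine ⟨⟨Φ (algebraMap E (AdeleRing (𝓞 E) E) q), units_transvection_mem_adelic F E c hJ2 ⟨i, j, hij, _⟩ (conjAdele_algebraMap_of_map_eq_neg F E c hqc)⟩ *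
      ⟨Φ r, units_transvection_mem_adelic F E c hJ2 ⟨i, j, hij, r⟩ hrc⟩, hON ?_, ?_⟩
  · change (Φ (algebraMap E (AdeleRing (𝓞 E) E) q) * Φ r) ∈ O
    rw [hΦmul]
    exact hsum
  · refine mul_mem (Subgroup.subset_closure (Or.inl (units_transvection_algebraMap_mem_image_toAdelic F E c hJ2 i j hij q hqc)))
      (Subgroup.subset_closure (Or.inr ⟨u, hu, hιu⟩))

end UnitaryGroup

end Literature.NumberTheory.Automorphic

end
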